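import Mathlib
import Summits.ValiantsHypothesis.ValiantsHypothesis.Theses.BarrierLever
import Summits.ValiantsHypothesis.ValiantsHypothesis.Theorems.BarrierLeverDefinableDcEquationsQuasiExponent

/-!
# Crux `BarrierLever.DefinableDcEquations` (stmt-8746) — one scale up the size/`dc` distinction
# disappears: definable equations for `VQP` (val-np-p5 g26, sequel to `…DcEquationsQuasiExponent`)

At the full quasi-polynomial scale `2^((log₂ n + 1)^C)` (every `C`) the size axis and the
determinantal axis cut out the same family of degree-`n` slices up to a shift of the exponent:
`L(f) ≤ 8(dc f + 1)^7 + (dc f)²(2n+1)` (tree `VNPVersusVPSPACE.complexity_le_of_dc_le`) and,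
conversely, `dc f ≤ 2^(17 E²)` whenever `deg f ≤ n < 2^E` and `L(f) ≤ 2^E` (tree
`determinantalComplexity_le_two_pow`, VSBR depth reduction; Bürgisser–Clausen–Shokrollahi 1997
Thm. (21.36)).  Hence "ONE level of boolean-sum equations against the degree-`n` slices of `VQP`"
is the same statement whether the slices are cut by circuit size or by determinantal complexity
(`vqpEquations_iff_vqpDcEquations`, exponent shifts `C ↦ C+6` / `C ↦ 2C+7`), and it implies crux 8746
(`definableDcEquations_of_vqpEquations`, via the growth-free normal form
`QuasiExponent.definableDcEquations_of_forallExponent`); `vqp_chain` records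
`DefEq(VQP) ⇒ DefinableDcEquations ⇒ DefinableEquations` (= crux 8745 ⟺ item 8749, `DefEq(VP)`).
Crux 8746 itself is pinned at the FIXED quasi-polynomial exponent `2` on the `dc` axis
(`dc ≤ 2^(C(log₂ n+1)²)`), where the two axes do NOT provably agree (depth reduction turns
`(log₂ n+1)²` into `(log₂ n+1)³`); that pinning is the entire difference between 8746 and the robust
statement `DefEq(VQP)`.

Reductions only: all items stay OPEN (Chatterjee–Tengse 2023 §1.3 direction 2); nothing here bears on
`SuccinctHittingSetsForVP` or on `VP ≠ VNP`, which is NOT proved.  No definitions, no named facts.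
Refs: Forbes–Shpilka–Volk 2018 Question 6; Chatterjee–Tengse arXiv:2309.07612 §1.3;
Bürgisser–Clausen–Shokrollahi 1997 Thm. (21.36)/(21.27); Valiant–Skyum–Berkowitz–Rackoff 1983.
-/

set_option linter.dupNamespace false

noncomputable section

namespace Summit.ValiantsHypothesis.ValiantsHypothesis.Theorems.BarrierLeverDefinableDcEquations

open MvPolynomial
open Literature.Computability.AlgebraicComplexity Literature.Barriers.ValiantsHypothesis
open Summit.ValiantsHypothesis.ValiantsHypothesis.Theses.BarrierLever
open Summit.ValiantsHypothesis.ValiantsHypothesis.Theorems.BarrierLeverDefinableEquations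
open scoped BigOperators

namespace VQPRobust

open QuasiExponent

/-! ## The two axes at polylogarithmic scale -/

/-- Arithmetic of the determinantal cost at a dyadic threshold: if `log₂ n + 1 ≤ K` then, with
`M = 2^K`, `8(M+1)^7 + M²(2n+1) ≤ 2^(7K+11)`. [folklore] -/
theorem dcCost_le_two_pow {n K : ℕ} (hK : Nat.log 2 n + 1 ≤ K) :
    8 * (2 ^ K + 1) ^ 7 + (2 ^ K) ^ 2 * (2 * n + 1) ≤ 2 ^ (7 * K + 11) := by
  have hn : n < 2 ^ (Nat.log 2 n + 1) := Nat.lt_pow_succ_log_self Nat.one_lt_two n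
  have hnK : n < 2 ^ K := hn.trans_le (Nat.pow_le_pow_right (by norm_num) hK)
  have h2n : 2 * n + 1 ≤ 2 ^ (K + 1) := by rw [pow_succ]; omega
  have hA : 8 * (2 ^ K + 1) ^ 7 ≤ 2 ^ (7 * K + 10) := by
    have h1 : 2 ^ K + 1 ≤ 2 ^ (K + 1) := by
      rw [pow_succ]; have := Nat.one_le_two_pow (n := K); omega
    calc 8 * (2 ^ K + 1) ^ 7 ≤ 8 * (2 ^ (K + 1)) ^ 7 := by gcongr
      _ = 2 ^ (7 * K + 10) := by
          rw [← pow_mul, show (8 : ℕ) = 2 ^ 3 by norm_num, ← pow_add]; ring_nf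
  have hB : (2 ^ K) ^ 2 * (2 * n + 1) ≤ 2 ^ (7 * K + 10) := by
    calc (2 ^ K) ^ 2 * (2 * n + 1) ≤ (2 ^ K) ^ 2 * 2 ^ (K + 1) := by gcongr
      _ = 2 ^ (3 * K + 1) := by rw [← pow_mul, ← pow_add]; ring_nf
      _ ≤ 2 ^ (7 * K + 10) := Nat.pow_le_pow_right (by norm_num) (by omega)
  calc 8 * (2 ^ K + 1) ^ 7 + (2 ^ K) ^ 2 * (2 * n + 1) ≤ 2 ^ (7 * K + 10) + 2 ^ (7 * K + 10) :=
        Nat.add_le_add hA hB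
    _ = 2 ^ (7 * K + 11) := by rw [pow_succ]; ring

/-- Exponent bookkeeping at polylogarithmic scale: for `n ≥ 2` (so `log₂ n + 1 ≥ 2`),
`7 (log₂ n+1)^C + 11 ≤ (log₂ n+1)^(C+5)`. [folklore] -/
theorem seven_mul_pow_add_le {n C : ℕ} (hn : 2 ≤ n) :
    7 * (Nat.log 2 n + 1) ^ C + 11 ≤ (Nat.log 2 n + 1) ^ (C + 5) := by
  set L := Nat.log 2 n with hL
  have hL1 : 1 ≤ L := by
    rw [hL]; exact Nat.le_log_of_pow_le (by norm_num) (by simpa using hn)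
  have h2 : 2 ≤ L + 1 := by omega
  have hpow : 1 ≤ (L + 1) ^ C := Nat.one_le_pow _ _ (by omega)
  have h32 : 32 ≤ (L + 1) ^ 5 := by
    calc (32 : ℕ) = 2 ^ 5 := by norm_num
      _ ≤ (L + 1) ^ 5 := Nat.pow_le_pow_left h2 5
  calc 7 * (L + 1) ^ C + 11 ≤ 7 * (L + 1) ^ C + 11 * (L + 1) ^ C := by nlinarith
    _ = 18 * (L + 1) ^ C := by ring
    _ ≤ (L + 1) ^ 5 * (L + 1) ^ C := by nlinarith
    _ = (L + 1) ^ (C + 5) := by rw [← pow_add, Nat.add_comm 5 C]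

/-- Exponent bookkeeping for depth reduction: for `n ≥ 2`,
`17 ((log₂ n+1)^(C+1))² ≤ (log₂ n+1)^(2C+7)`. [folklore] -/
theorem seventeen_mul_sq_le {n C : ℕ} (hn : 2 ≤ n) :
    17 * ((Nat.log 2 n + 1) ^ (C + 1)) ^ 2 ≤ (Nat.log 2 n + 1) ^ (2 * C + 7) := by
  set L := Nat.log 2 n with hL
  have hL1 : 1 ≤ L := by
    rw [hL]; exact Nat.le_log_of_pow_le (by norm_num) (by simpa using hn)
  have h2 : 2 ≤ L + 1 := by omega
  have h32 : 32 ≤ (L + 1) ^ 5 := by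
    calc (32 : ℕ) = 2 ^ 5 := by norm_num
      _ ≤ (L + 1) ^ 5 := Nat.pow_le_pow_left h2 5
  have hsq : ((L + 1) ^ (C + 1)) ^ 2 = (L + 1) ^ (2 * C + 2) := by rw [← pow_mul]; ring_nf
  rw [hsq]
  calc 17 * (L + 1) ^ (2 * C + 2) ≤ (L + 1) ^ 5 * (L + 1) ^ (2 * C + 2) := by nlinarith
    _ = (L + 1) ^ (2 * C + 7) := by rw [← pow_add]; ring_nf

/-- From the determinantal axis to the size axis at polylogarithmic scale: for `n ≥ 2` and
`C ≥ 1`, `dc f ≤ 2^((log₂ n+1)^C) ⇒ L(f) ≤ 2^((log₂ n+1)^(C+5))`. [folklore] -/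
theorem complexity_le_of_dc_le_polylog {n C : ℕ} (hn : 2 ≤ n) (hC : 1 ≤ C)
    {f : MvPolynomial (Fin n) ℂ} (hdc : determinantalComplexity f ≤ 2 ^ ((Nat.log 2 n + 1) ^ C)) :
    complexity f ≤ 2 ^ ((Nat.log 2 n + 1) ^ (C + 5)) := by
  have hK : Nat.log 2 n + 1 ≤ (Nat.log 2 n + 1) ^ C :=
    calc Nat.log 2 n + 1 = (Nat.log 2 n + 1) ^ 1 := (pow_one _).symm
      _ ≤ (Nat.log 2 n + 1) ^ C := Nat.pow_le_pow_right (Nat.succ_pos _) hC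
  calc complexity f ≤ 8 * (2 ^ ((Nat.log 2 n + 1) ^ C) + 1) ^ 7 +
        (2 ^ ((Nat.log 2 n + 1) ^ C)) ^ 2 * (2 * n + 1) :=
        VNPVersusVPSPACE.complexity_le_of_dc_le hdc
    _ ≤ 2 ^ (7 * (Nat.log 2 n + 1) ^ C + 11) := dcCost_le_two_pow hK
    _ ≤ 2 ^ ((Nat.log 2 n + 1) ^ (C + 5)) :=
        Nat.pow_le_pow_right (by norm_num) (seven_mul_pow_add_le hn)

/-- From the size axis to the determinantal axis at polylogarithmic scale (depth reduction): for
`n ≥ 2`, `deg f ≤ n` and `L(f) ≤ 2^((log₂ n+1)^C)` give `dc f ≤ 2^((log₂ n+1)^(2C+7))`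
(`determinantalComplexity_le_two_pow` at `E = (log₂ n+1)^(C+1)`). [folklore] -/
theorem dc_le_of_complexity_le_polylog {n C : ℕ} (hn : 2 ≤ n) {f : MvPolynomial (Fin n) ℂ}
    (hdeg : f.totalDegree ≤ n) (hc : complexity f ≤ 2 ^ ((Nat.log 2 n + 1) ^ C)) :
    determinantalComplexity f ≤ 2 ^ ((Nat.log 2 n + 1) ^ (2 * C + 7)) := by
  set E := (Nat.log 2 n + 1) ^ (C + 1) with hE
  have hLE : Nat.log 2 n + 1 ≤ E := by
    rw [hE, pow_succ]
    exact Nat.le_mul_of_pos_left _ (Nat.pow_pos (Nat.succ_pos _))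
  have hCE : (Nat.log 2 n + 1) ^ C ≤ E := by
    rw [hE, pow_succ]
    exact Nat.le_mul_of_pos_right _ (Nat.succ_pos _)
  have hE1 : 1 ≤ E := le_trans (Nat.succ_le_succ (Nat.zero_le _)) hLE
  have hd : n < 2 ^ E :=
    (Nat.lt_pow_succ_log_self Nat.one_lt_two n).trans_le (Nat.pow_le_pow_right (by norm_num) hLE)
  have hL : complexity f ≤ 2 ^ E := hc.trans (Nat.pow_le_pow_right (by norm_num) hCE)
  calc determinantalComplexity f ≤ 2 ^ (17 * E ^ 2) :=
        determinantalComplexity_le_two_pow hdeg hd hL hE1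
    _ ≤ 2 ^ ((Nat.log 2 n + 1) ^ (2 * C + 7)) :=
        Nat.pow_le_pow_right (by norm_num) (by rw [hE]; exact seventeen_mul_sq_le hn)

/-- **`DefEq(VQP)` is robust: size slices versus determinantal slices.**  ONE level of boolean-sum
equations against `{deg f ≤ n, L(f) ≤ 2^((log₂ n+1)^C)}` for every `C` holds iff ONE level of
boolean-sum equations against `{deg f ≤ n, dc f ≤ 2^((log₂ n+1)^C)}` for every `C` holds (exponent
shifts `C ↦ C + 6`, resp. `C ↦ 2C + 7`; onsets moved past `n = 2`). [folklore] -/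
theorem vqpEquations_iff_vqpDcEquations :
    (∃ a : ℕ, ∀ C : ℕ, ∃ n₀ : ℕ, ∀ n ≥ n₀, ∃ q : ℕ, q ≤ (Nat.choose (2 * n) n) ^ a ∧
      ∃ H : MvPolynomial (↥(degLEMonomials n) ⊕ Fin q) ℂ,
        complexity H ≤ (Nat.choose (2 * n) n) ^ a ∧ H.totalDegree ≤ (Nat.choose (2 * n) n) ^ a ∧
        boolSum H ≠ 0 ∧
        ∀ f : MvPolynomial (Fin n) ℂ, f.totalDegree ≤ n →
          complexity f ≤ 2 ^ ((Nat.log 2 n + 1) ^ C) →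
          eval (coeffVector (degLEMonomials n) f) (boolSum H) = 0) ↔
    (∃ a : ℕ, ∀ C : ℕ, ∃ n₀ : ℕ, ∀ n ≥ n₀, ∃ q : ℕ, q ≤ (Nat.choose (2 * n) n) ^ a ∧
      ∃ H : MvPolynomial (↥(degLEMonomials n) ⊕ Fin q) ℂ,
        complexity H ≤ (Nat.choose (2 * n) n) ^ a ∧ H.totalDegree ≤ (Nat.choose (2 * n) n) ^ a ∧
        boolSum H ≠ 0 ∧
        ∀ f : MvPolynomial (Fin n) ℂ, f.totalDegree ≤ n →
          determinantalComplexity f ≤ 2 ^ ((Nat.log 2 n + 1) ^ C) →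
          eval (coeffVector (degLEMonomials n) f) (boolSum H) = 0) := by
  constructor
  · rintro ⟨a, h⟩
    refine ⟨a, fun C => ?_⟩
    -- the `dc`-slice at exponent `C` sits inside the size slice at exponent `(C+1)+5`
    obtain ⟨n₀, hn₀⟩ := h (C + 1 + 5)
    refine ⟨max n₀ 2, fun n hn => ?_⟩
    have h2 : 2 ≤ n := le_trans (le_max_right _ _) hn
    obtain ⟨q, hq, H, hHc, hHd, hne, hvan⟩ := hn₀ n (le_trans (le_max_left _ _) hn)
    refine ⟨q, hq, H, hHc, hHd, hne, fun f hfd hdc => hvan f hfd ?_⟩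
    have hdc' : determinantalComplexity f ≤ 2 ^ ((Nat.log 2 n + 1) ^ (C + 1)) :=
      hdc.trans (Nat.pow_le_pow_right (by norm_num)
        (Nat.pow_le_pow_right (Nat.succ_pos _) (Nat.le_succ C)))
    exact complexity_le_of_dc_le_polylog h2 (Nat.le_add_left 1 C) hdc'
  · rintro ⟨a, h⟩
    refine ⟨a, fun C => ?_⟩
    obtain ⟨n₀, hn₀⟩ := h (2 * C + 7)
    refine ⟨max n₀ 2, fun n hn => ?_⟩
    have h2 : 2 ≤ n := le_trans (le_max_right _ _) hn
    obtain ⟨q, hq, H, hHc, hHd, hne, hvan⟩ := hn₀ n (le_trans (le_max_left _ _) hn)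
    exact ⟨q, hq, H, hHc, hHd, hne,
      fun f hfd hc => hvan f hfd (dc_le_of_complexity_le_polylog h2 hfd hc)⟩

/-- **`DefEq(VQP)` ⇒ crux 8746.**  One level of boolean-sum equations against the degree-`n`
slices of `VQP` (`L(f) ≤ 2^((log₂ n+1)^C)`, every `C`) implies `DefinableDcEquations`: pass to the
determinantal axis (`vqpEquations_iff_vqpDcEquations`), note
`2^(C(log₂ n+1)²) ≤ 2^((log₂ n+1)^(C+2))` for `n ≥ 2`, and diagonalise (§2). [folklore] -/
theorem definableDcEquations_of_vqpEquations
    (h : ∃ a : ℕ, ∀ C : ℕ, ∃ n₀ : ℕ, ∀ n ≥ n₀, ∃ q : ℕ, q ≤ (Nat.choose (2 * n) n) ^ a ∧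
      ∃ H : MvPolynomial (↥(degLEMonomials n) ⊕ Fin q) ℂ,
        complexity H ≤ (Nat.choose (2 * n) n) ^ a ∧ H.totalDegree ≤ (Nat.choose (2 * n) n) ^ a ∧
        boolSum H ≠ 0 ∧
        ∀ f : MvPolynomial (Fin n) ℂ, f.totalDegree ≤ n →
          complexity f ≤ 2 ^ ((Nat.log 2 n + 1) ^ C) →
          eval (coeffVector (degLEMonomials n) f) (boolSum H) = 0) :
    DefinableDcEquations := by
  obtain ⟨a, hdc⟩ := vqpEquations_iff_vqpDcEquations.mp h
  refine definableDcEquations_of_forallExponent ⟨a, fun C => ?_⟩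
  obtain ⟨n₀, hn₀⟩ := hdc (C + 2)
  refine ⟨max n₀ 2, fun n hn => ?_⟩
  have h2 : 2 ≤ n := le_trans (le_max_right _ _) hn
  obtain ⟨q, hq, H, hHc, hHd, hne, hvan⟩ := hn₀ n (le_trans (le_max_left _ _) hn)
  refine ⟨q, hq, H, hHc, hHd, hne, fun f hfd hfdc => hvan f hfd (hfdc.trans ?_)⟩
  apply Nat.pow_le_pow_right (by norm_num)
  -- `C (L+1)² ≤ (L+1)^C (L+1)² = (L+1)^(C+2)` since `C ≤ 2^C ≤ (L+1)^C` for `L + 1 ≥ 2`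
  have hL2 : 2 ≤ Nat.log 2 n + 1 := by
    have : 1 ≤ Nat.log 2 n := Nat.le_log_of_pow_le (by norm_num) (by simpa using h2)
    omega
  have hCle : C ≤ (Nat.log 2 n + 1) ^ C :=
    (Nat.lt_two_pow_self).le.trans (Nat.pow_le_pow_left hL2 C)
  calc C * (Nat.log 2 n + 1) ^ 2 ≤ (Nat.log 2 n + 1) ^ C * (Nat.log 2 n + 1) ^ 2 :=
        Nat.mul_le_mul_right _ hCle
    _ = (Nat.log 2 n + 1) ^ (C + 2) := by rw [← pow_add]

/-- **The full chain on the size/`dc` axis, recorded**: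
`DefEq(VQP)` (robust: size slices ⟺ dc slices, every polylog exponent) ⇒
`[∃ a ∀ C, Eq_a(L ≤ 2^(C(log₂ n+1)²))]`-free form of crux 8746, i.e. `DefinableDcEquations` ⇒
`DefinableEquations` (= crux 8745 ⟺ item 8749, `DefEq(VP)`). [folklore] -/
theorem vqp_chain :
    ((∃ a : ℕ, ∀ C : ℕ, ∃ n₀ : ℕ, ∀ n ≥ n₀, ∃ q : ℕ, q ≤ (Nat.choose (2 * n) n) ^ a ∧
        ∃ H : MvPolynomial (↥(degLEMonomials n) ⊕ Fin q) ℂ,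
          complexity H ≤ (Nat.choose (2 * n) n) ^ a ∧ H.totalDegree ≤ (Nat.choose (2 * n) n) ^ a ∧
          boolSum H ≠ 0 ∧
          ∀ f : MvPolynomial (Fin n) ℂ, f.totalDegree ≤ n →
            complexity f ≤ 2 ^ ((Nat.log 2 n + 1) ^ C) →
            eval (coeffVector (degLEMonomials n) f) (boolSum H) = 0) → DefinableDcEquations) ∧
    (DefinableDcEquations → DefinableEquations) :=
  ⟨definableDcEquations_of_vqpEquations,
    Summit.ValiantsHypothesis.ValiantsHypothesis.Theorems.dcSliceCoversVP_proof⟩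

end VQPRobust

end Summit.ValiantsHypothesis.ValiantsHypothesis.Theorems.BarrierLeverDefinableDcEquations

end
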